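import Mathlib.Analysis.SpecialFunctions.Log.Deriv
import Mathlib.Analysis.SpecialFunctions.Trigonometric.Bounds
import HarnessLib

/-!
# The tilted-cosine lower bound of Fröhlich–Spencer's Jensen step

Support file of the proof programme of the named fact
`Literature.MathematicalPhysics.QuantumFieldTheory.FrohlichSpencerU1PerimeterLawD4`.
In the last step of their proof of the perimeter law (Fröhlich–Spencer 1982, §2.10, the display
between (2.78) and (2.79)), the phases `θ_ρ` of the renormalised monopole factors
`1 + z(β,ρ) cos(ᾱ(ρ) - θ_ρ)` are pulled out of the (positive) measure by the elementary estimate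

  `1 + z cos(α - θ) ≥ (1 + z cos α) · exp[E(α,θ) + O(α,θ) - γ(z) θ²]`,

`E = (1 + z cos α)⁻¹ z cos α (cos θ - 1)`, `O = (1 + z cos α)⁻¹ z sin α sin θ` ("Taylor's theorem
with remainder, applied to the function `log(1 + x)`, along with elementary estimates on
trigonometric functions"), after which `O`, being odd in `α`, drops out under Jensen's inequality
in the even measure, and `γ(z) θ²` is summed against the Coulomb energy ((2.80)–(2.88)).

We prove it in the explicit form used downstream, with `E` already absorbed into the quadratic
term and the concrete constant `γ(z) = z`:

* `one_add_mul_cos_sub_ge`: for `0 ≤ z ≤ 1/16` and all real `α, θ`,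
  `(1 + z cos α) · exp(z sin α sin θ / (1 + z cos α) - z θ²) ≤ 1 + z cos(α - θ)`;
* `oddTilt_neg`: the exponent's first term is odd in `α`.

No smallness of `θ` is needed. Ingredients: the algebraic identity
`1 + z cos(α - θ) = (1 + z cos α)(1 + E + O)`, the logarithmic bound `log(1 + x) ≥ x - 2x²` for
`|x| ≤ 1/2` (Mathlib's Taylor remainder `Real.abs_log_sub_add_sum_range_le`), and
`1 - cos θ ≤ θ²/2`. Everything is proved; no named fact is introduced.

## References

* J. Fröhlich, T. Spencer, Comm. Math. Phys. 83 (1982) 411–454, §2.10, the estimate preceding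
  (2.79) and its use in (2.79)–(2.80). [FrohlichSpencerCMP1982]
-/

noncomputable section

open Real

namespace Literature.MathematicalPhysics.QuantumFieldTheory

namespace CosineTilt

/-- The odd part of the tilt: `O(z, α, θ) = z sin α sin θ / (1 + z cos α)`. [cite: FrohlichSpencerCMP1982, §2.10 (O(α,θ) in the display before (2.79))] -/
def oddTilt (z α θ : ℝ) : ℝ := z * sin α * sin θ / (1 + z * cos α)

/-- `O` is odd in `α` (so that it drops out of even expectations). [cite: FrohlichSpencerCMP1982, §2.10 ("O is odd in α")] -/
theorem oddTilt_neg (z α θ : ℝ) : oddTilt z (-α) θ = -oddTilt z α θ := by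
  simp only [oddTilt, sin_neg, cos_neg]
  ring

/-- `O` is odd in `θ` as well. [folklore] -/
theorem oddTilt_neg_right (z α θ : ℝ) : oddTilt z α (-θ) = -oddTilt z α θ := by
  simp only [oddTilt, sin_neg]
  ring

/-- The logarithmic bound `log(1 + x) ≥ x - 2x²` for `|x| ≤ 1/2` (Taylor with remainder). [folklore] -/
theorem sub_two_mul_sq_le_log_one_add {x : ℝ} (hx : |x| ≤ 1 / 2) : x - 2 * x ^ 2 ≤ log (1 + x) := by
  have hx1 : |(-x)| < 1 := by rw [abs_neg]; linarith
  have h := Real.abs_log_sub_add_sum_range_le hx1 1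
  simp only [Finset.sum_range_one, zero_add, pow_one, sub_neg_eq_add, abs_neg] at h
  -- `h : |-x + log (1 + x)| ≤ |x| ^ 2 / (1 - |x|)`
  have h1 : |x| ^ 2 / (1 - |x|) ≤ 2 * x ^ 2 := by
    rw [div_le_iff₀ (by linarith), sq_abs]
    nlinarith [sq_nonneg x, abs_nonneg x]
  have h2 := (abs_le.1 (h.trans h1)).1
  linarith

/-- **Fröhlich–Spencer's tilted-cosine lower bound** (with `E` absorbed and `γ(z) = z`): for
`0 ≤ z ≤ 1/16` and all real `α, θ`,
`(1 + z cos α) · exp(z sin α sin θ / (1 + z cos α) - z θ²) ≤ 1 + z cos(α - θ)`.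
[cite: FrohlichSpencerCMP1982, §2.10, the estimate preceding (2.79)] -/
theorem one_add_mul_cos_sub_ge {z : ℝ} (hz0 : 0 ≤ z) (hz : z ≤ 1 / 16) (α θ : ℝ) :
    (1 + z * cos α) * exp (oddTilt z α θ - z * θ ^ 2) ≤ 1 + z * cos (α - θ) := by
  -- the positive denominator
  set D := 1 + z * cos α with hD
  have hcosα := abs_le.1 (abs_cos_le_one α)
  have hcosθ := abs_le.1 (abs_cos_le_one θ)
  have hsinα := abs_le.1 (abs_sin_le_one α)
  have hsinθ := abs_le.1 (abs_sin_le_one θ)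
  have hD0 : 15 / 16 ≤ D := by rw [hD]; nlinarith
  have hDpos : 0 < D := by linarith
  -- the two parts of the tilt
  set E := z * cos α * (cos θ - 1) / D with hE
  set O := z * sin α * sin θ / D with hO
  have hO' : oddTilt z α θ = O := rfl
  -- the algebraic identity
  have hDne' : 1 + z * cos α ≠ 0 := hD ▸ hDpos.ne'
  have hid : 1 + z * cos (α - θ) = D * (1 + (E + O)) := by
    rw [cos_sub, hE, hO, hD]
    field_simp
    ring
  -- smallness of the tilt
  have hEabs : |E| ≤ 2 * z / D := by
    rw [hE, abs_div, abs_of_pos hDpos, div_le_div_iff_of_pos_right hDpos, abs_mul, abs_mul,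
      abs_of_nonneg hz0]
    have h1 : |cos α| ≤ 1 := abs_cos_le_one α
    have h2 : |cos θ - 1| ≤ 2 := by rw [abs_le]; constructor <;> linarith
    calc z * |cos α| * |cos θ - 1| ≤ z * 1 * 2 := by gcongr
      _ = 2 * z := by ring
  have hOabs : |O| ≤ z / D := by
    rw [hO, abs_div, abs_of_pos hDpos, div_le_div_iff_of_pos_right hDpos, abs_mul, abs_mul,
      abs_of_nonneg hz0]
    calc z * |sin α| * |sin θ| ≤ z * 1 * 1 := by gcongr <;> simp [abs_sin_le_one]
      _ = z := by ring
  have hx : |E + O| ≤ 1 / 2 := by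
    have h3 : 3 * z / D ≤ 1 / 2 := by
      rw [div_le_iff₀ hDpos]; linarith
    calc |E + O| ≤ |E| + |O| := abs_add_le _ _
      _ ≤ 2 * z / D + z / D := add_le_add hEabs hOabs
      _ = 3 * z / D := by ring
      _ ≤ 1 / 2 := h3
  -- the quadratic remainder: `(E + O)² ≤ 2 (z/D)² θ²`
  have hcosq : 1 - cos θ ≤ θ ^ 2 / 2 := by linarith [Real.one_sub_sq_div_two_le_cos (x := θ)]
  have hsq : (E + O) ^ 2 ≤ 2 * (z / D) ^ 2 * θ ^ 2 := by
    have h1 : (E + O) ^ 2 ≤ 2 * E ^ 2 + 2 * O ^ 2 := by nlinarith [sq_nonneg (E - O)]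
    have h2 : E ^ 2 + O ^ 2 ≤ (z / D) ^ 2 * (2 - 2 * cos θ) := by
      have hE2 : E ^ 2 = (z / D) ^ 2 * (cos α ^ 2 * (cos θ - 1) ^ 2) := by rw [hE]; ring
      have hO2 : O ^ 2 = (z / D) ^ 2 * (sin α ^ 2 * sin θ ^ 2) := by rw [hO]; ring
      rw [hE2, hO2, ← mul_add]
      refine mul_le_mul_of_nonneg_left ?_ (sq_nonneg _)
      have hc2 : cos α ^ 2 ≤ 1 := cos_sq_le_one α
      have hs2 : sin α ^ 2 ≤ 1 := sin_sq_le_one α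
      calc cos α ^ 2 * (cos θ - 1) ^ 2 + sin α ^ 2 * sin θ ^ 2
          ≤ 1 * (cos θ - 1) ^ 2 + 1 * sin θ ^ 2 := by gcongr
        _ = 2 - 2 * cos θ := by linear_combination sin_sq_add_cos_sq θ
    have h3 : (z / D) ^ 2 * (2 - 2 * cos θ) ≤ (z / D) ^ 2 * θ ^ 2 :=
      mul_le_mul_of_nonneg_left (by linarith) (sq_nonneg _)
    linarith
  -- the even part is bounded below by a quadratic
  have hElow : -(z / D) * (θ ^ 2 / 2) ≤ E := by
    rw [hE]
    rcases le_or_gt 0 (cos α) with hc | hc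
    · -- `cos α ≥ 0`: `E ≥ z cos α (-(θ²/2)) / D ≥ -(z/D) θ²/2`
      have h1 : -(θ ^ 2 / 2) ≤ cos θ - 1 := by linarith
      have h2 : z * cos α * (-(θ ^ 2 / 2)) ≤ z * cos α * (cos θ - 1) :=
        mul_le_mul_of_nonneg_left h1 (mul_nonneg hz0 hc)
      have h3 : z * 1 * (-(θ ^ 2 / 2)) ≤ z * cos α * (-(θ ^ 2 / 2)) :=
        mul_le_mul_of_nonpos_right (mul_le_mul_of_nonneg_left hcosα.2 hz0)
          (by nlinarith [sq_nonneg θ])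
      have h4 : -(z / D) * (θ ^ 2 / 2) = z * 1 * (-(θ ^ 2 / 2)) / D := by ring
      rw [h4]
      exact div_le_div_of_nonneg_right (h3.trans h2) hDpos.le
    · -- `cos α < 0`: `E ≥ 0`
      have h1 : 0 ≤ z * cos α * (cos θ - 1) / D :=
        div_nonneg (mul_nonneg_of_nonpos_of_nonpos (mul_nonpos_of_nonneg_of_nonpos hz0 hc.le)
          (by linarith)) hDpos.le
      have h2 : 0 ≤ z / D * (θ ^ 2 / 2) := by positivity
      linarith
  -- assemble the exponent bound: `O - z θ² ≤ log (1 + (E + O))`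
  have hlog : O - z * θ ^ 2 ≤ log (1 + (E + O)) := by
    have h1 := sub_two_mul_sq_le_log_one_add hx
    -- `E - 2 (E+O)² ≥ -z θ²`
    have hzD : z / D ≤ 16 / 15 * z := by
      rw [div_le_iff₀ hDpos]; nlinarith
    have h2 : z / D * (θ ^ 2 / 2) + 2 * (2 * (z / D) ^ 2 * θ ^ 2) ≤ z * θ ^ 2 := by
      have hzD0 : 0 ≤ z / D := div_nonneg hz0 hDpos.le
      have hθ : 0 ≤ θ ^ 2 := sq_nonneg θ
      have h5 : (z / D) ^ 2 ≤ 1 / 15 * (z / D) := by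
        rw [sq]
        calc z / D * (z / D) ≤ 16 / 15 * z * (z / D) := mul_le_mul_of_nonneg_right hzD hzD0
          _ ≤ 16 / 15 * (1 / 16) * (z / D) := by gcongr
          _ = 1 / 15 * (z / D) := by norm_num
      have h5' : (z / D) ^ 2 * θ ^ 2 ≤ 1 / 15 * (z / D) * θ ^ 2 := mul_le_mul_of_nonneg_right h5 hθ
      have hzD' : z / D * θ ^ 2 ≤ 16 / 15 * z * θ ^ 2 := mul_le_mul_of_nonneg_right hzD hθ
      have hz' : 0 ≤ z * θ ^ 2 := mul_nonneg hz0 hθ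
      linarith
    linarith
  -- conclude
  calc D * exp (oddTilt z α θ - z * θ ^ 2) = D * exp (O - z * θ ^ 2) := by rw [hO']
    _ ≤ D * exp (log (1 + (E + O))) := mul_le_mul_of_nonneg_left (exp_le_exp.2 hlog) hDpos.le
    _ = D * (1 + (E + O)) := by
        rw [exp_log]
        linarith [(abs_le.1 hx).1]
    _ = 1 + z * cos (α - θ) := hid.symm

/-- The same bound with the tilt written out. [cite: FrohlichSpencerCMP1982, §2.10, the estimate preceding (2.79)] -/
theorem one_add_mul_cos_sub_ge' {z : ℝ} (hz0 : 0 ≤ z) (hz : z ≤ 1 / 16) (α θ : ℝ) :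
    (1 + z * cos α) * exp (z * sin α * sin θ / (1 + z * cos α) - z * θ ^ 2) ≤ 1 + z * cos (α - θ) :=
  one_add_mul_cos_sub_ge hz0 hz α θ

/-- Positivity of the untilted factor for `0 ≤ z < 1`. [folklore] -/
theorem one_add_mul_cos_pos {z : ℝ} (hz0 : 0 ≤ z) (hz : z < 1) (α : ℝ) : 0 < 1 + z * cos α := by
  nlinarith [abs_le.1 (abs_cos_le_one α)]

end CosineTilt

end Literature.MathematicalPhysics.QuantumFieldTheory
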